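import Mathlib.Topology.Order.IntermediateValue
import Mathlib.MeasureTheory.Measure.Haar.Unique
import Summits.AtomisticToContinuum.HydrodynamicLimit.Theorems.MourreKoopmanChargesStressStrongMixingStressFramework
import Summits.AtomisticToContinuum.HydrodynamicLimit.Theorems.MourreKoopmanChargesStressStrongMixingGibbsDilation
import Literature.MathematicalPhysics.StatisticalMechanics.DiluteHardSphereGas
import HarnessLib

/-!
# `StressStrongMixing` · line `birth`, stub F1 `stub_diluteGibbsDensityOne` (infrastructure 2/2 and assembly):
# the intensity measure, the density of a dilated state, and F1 from `RuelleDiluteHardSphereGas`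

Support file for the crux item stmt-AtomisticToContinuum-9584 (`StressStrongMixing`, route
`MourreKoopmanCharges` of `AtomisticToContinuum/HydrodynamicLimit`), serving the registered stub F1
`stub_diluteGibbsDensityOne` of the skeleton `Cruxes/StressStrongMixing/Lines/birth.lean`:

  `∃ σ₁ > 0, ∀ σ ∈ (0, σ₁), ∀ θ > 0, ∃ z > 0, ∃ μ : Measure MarkedConfig,`
  `IsHardSphereGibbs σ z θ⁻¹ 0 μ ∧ IsTranslationInvariant μ ∧ PointProcess.density μ = 1`.

The stub is NOT closed here: the only infinite-volume hard-sphere Gibbs states in the tree come from the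
UNPROVED named fact `Literature.MathematicalPhysics.StatisticalMechanics.RuelleDiluteHardSphereGas`
(Ruelle 1969 Thm 4.2.3 / 4.3.1, Dobrushin–Sinai–Sukhov Ch. 10 §2.4–2.5: at UNIT diameter, for
`0 < z < z₁`, a translation-invariant DLR state of density `ρ(z)`, `ρ` continuous with
`z - Cz² ≤ ρ(z) ≤ z`).  What this file proves is the honest REDUCTION
`diluteGibbsDensityOne_of_ruelle : RuelleDiluteHardSphereGas → (F1 verbatim)` (REGISTERED helper stub),
together with the piece of point-process statics it needs (no new definition is introduced; the
intensity measure is written out as `(μ.bind PointConfig.countKernel).map Prod.fst`):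

* the INTENSITY (first-moment) MEASURE of the positions of a law `μ` on phase-space configurations,
  `Λ ↦ E_μ[N(Λ × ℝᵈ)]`, is the `bind` of `μ` with the tree's counting kernel `PointConfig.countKernel`
  projected to positions (`bind_countKernel_map_fst_apply`); the density is its value on `[0,1)ᵈ`;
* for translation-invariant `μ` it is a translation-invariant Borel measure
  (`isAddLeftInvariant_bind_countKernel_map_fst`), finite on compacts as soon as the density is finite,
  hence a constant multiple of Lebesgue measure (`exists_bind_countKernel_map_fst_eq_smul_volume`,
  Mathlib's uniqueness of Haar measure `Measure.isAddLeftInvariant_eq_smul`), so that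
  `E_μ[N(c⁻¹Λ × ℝᵈ)] = |c|⁻ᵈ E_μ[N(Λ × ℝᵈ)]` (`lintegral_count_preimage_smul`);
* `density_map_dilate`: the density of the dilated state `μ ∘ D⁻¹`, `D(q, v) = (cq, v)`, is
  `c⁻ᵈ · density μ`;
* the assembly: with `σ₁ := min 1 (min (z₁/4) (1/(4C+4)))` and `s := σ³`, the intermediate value
  theorem on `[s, 2s] ⊆ (0, z₁)` (`ρ(s) ≤ s ≤ 2s - 4Cs² ≤ ρ(2s)`) gives `z⋆` with `ρ(z⋆) = σ³` (the
  pattern of `…KiferDiluteGibbs.stub_diluteGibbsStateOfFact`); the unit-diameter state at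
  `(z⋆, β = θ⁻¹, u = 0)` dilated by `σ` (`D := (Homeomorph.smulOfNeZero σ _).prodCongr (Homeomorph.refl _)`)
  is a Gibbs state of diameter `σ`, activity `z⋆/σ³ > 0`, translation invariant, of density
  `σ⁻³ · σ³ = 1` (`IsHardSphereGibbs.map_dilate`, `isTranslationInvariant_map_dilate` of the companion
  file `…StressStrongMixingGibbsDilation.lean`, and `density_map_dilate`).

References: D. Ruelle, *Statistical Mechanics: Rigorous Results* (1969), Thm 4.2.3, §3.4.1;
D. J. Daley, D. Vere-Jones, *An Introduction to the Theory of Point Processes* II (2008), Prop. 12.2.I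
(the first-moment measure of a stationary point process is a multiple of Lebesgue measure).
-/

noncomputable section

open MeasureTheory ProbabilityTheory Filter Topology Set Function
open scoped InnerProductSpace ENNReal NNReal

namespace Summit.AtomisticToContinuum.HydrodynamicLimit.Theorems.MourreKoopmanChargesStressStrongMixing

open Literature.MathematicalPhysics.KineticTheory Literature.Analysis.FluidPDE Literature.Analysis.FunctionSpaces
open Literature.MathematicalPhysics.StatisticalMechanics (RuelleDiluteHardSphereGas)

section Intensity

variable {d : Type*} [Fintype d]

/-! ## The intensity measure of positions -/

/-- **The intensity measure counts particles**: the `bind` of `μ` with the counting kernel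
`ω ↦ ∑_{p ∈ ω} δ_p`, projected to positions, is `Λ ↦ E_μ[N(Λ × ℝᵈ)]` on measurable `Λ`
(Daley–Vere-Jones §9.5, the first-moment measure; DSS §2.7 (10.31)). -/
theorem bind_countKernel_map_fst_apply
    (μ : Measure (PointConfig (EuclideanSpace ℝ d × EuclideanSpace ℝ d))) {Λ : Set (EuclideanSpace ℝ d)}
    (hΛ : MeasurableSet Λ) :
    (μ.bind PointConfig.countKernel).map Prod.fst Λ = ∫⁻ ω, ((ω.count (Prod.fst ⁻¹' Λ) : ℕ∞) : ℝ≥0∞) ∂μ := by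
  rw [Measure.map_apply measurable_fst hΛ,
    Measure.bind_apply (measurable_fst hΛ) (PointConfig.countKernel.measurable).aemeasurable]
  refine lintegral_congr fun ω => ?_
  rw [PointConfig.countKernel_apply, PointConfig.toMeasure_apply _ (measurable_fst hΛ)]

/-- The density is the intensity of the unit cube. -/
theorem density_eq_bind_countKernel_map_fst_unitCube
    (μ : Measure (PointConfig (EuclideanSpace ℝ d × EuclideanSpace ℝ d))) :
    PointProcess.density μ = (μ.bind PointConfig.countKernel).map Prod.fst (Torus.unitCube d) :=
  (bind_countKernel_map_fst_apply μ Torus.measurableSet_unitCube).symm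

/-- **The intensity measure of a translation-invariant law is translation invariant.** -/
theorem isAddLeftInvariant_bind_countKernel_map_fst
    {μ : Measure (PointConfig (EuclideanSpace ℝ d × EuclideanSpace ℝ d))} (h : IsTranslationInvariant μ) :
    ((μ.bind PointConfig.countKernel).map Prod.fst).IsAddLeftInvariant := by
  refine ⟨fun a => Measure.ext fun s hs => ?_⟩
  rw [Measure.map_apply (measurable_const_add a) hs,
    bind_countKernel_map_fst_apply μ (measurable_const_add a hs), bind_countKernel_map_fst_apply μ hs]
  calc ∫⁻ ω, (((ω.count (Prod.fst ⁻¹' ((a + ·) ⁻¹' s)) : ℕ∞)) : ℝ≥0∞) ∂μ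
      = ∫⁻ ω, (((ω.translate ((a, 0) : EuclideanSpace ℝ d × EuclideanSpace ℝ d)).count (Prod.fst ⁻¹' s) : ℕ∞) :
          ℝ≥0∞) ∂μ := by
        have hset : (Prod.fst ⁻¹' ((a + ·) ⁻¹' s) : Set (EuclideanSpace ℝ d × EuclideanSpace ℝ d)) =
            (· + ((a, 0) : EuclideanSpace ℝ d × EuclideanSpace ℝ d)) ⁻¹' (Prod.fst ⁻¹' s) := by
          ext p
          simp [add_comm]
        refine lintegral_congr fun ω => ?_
        rw [PointConfig.count_translate, hset]
    _ = ∫⁻ ω, ((ω.count (Prod.fst ⁻¹' s) : ℕ∞) : ℝ≥0∞)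
          ∂(μ.map (PointConfig.translate ((a, 0) : EuclideanSpace ℝ d × EuclideanSpace ℝ d))) :=
        (lintegral_map (PointProcess.measurable_count_window hs) (PointConfig.measurable_translate _)).symm
    _ = ∫⁻ ω, ((ω.count (Prod.fst ⁻¹' s) : ℕ∞) : ℝ≥0∞) ∂μ := by rw [h a]

omit [Fintype d] in
/-- The unit cube `[0,1)ᵈ` has nonempty interior (it contains the open cube `(0,1)ᵈ`). -/
theorem interior_unitCube_nonempty [Finite d] : (interior (Torus.unitCube d)).Nonempty := by
  have hU : IsOpen {y : EuclideanSpace ℝ d | ∀ i, y i ∈ Ioo (0 : ℝ) 1} := by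
    have : {y : EuclideanSpace ℝ d | ∀ i, y i ∈ Ioo (0 : ℝ) 1} =
        ⋂ i, (fun y : EuclideanSpace ℝ d => y i) ⁻¹' Ioo 0 1 := by
      ext y; simp
    rw [this]
    exact isOpen_iInter_of_finite fun i => isOpen_Ioo.preimage (by fun_prop)
  have hsub : {y : EuclideanSpace ℝ d | ∀ i, y i ∈ Ioo (0 : ℝ) 1} ⊆ Torus.unitCube d :=
    fun y hy i => ⟨(hy i).1.le, (hy i).2⟩
  refine ⟨WithLp.toLp 2 (fun _ => (1 / 2 : ℝ)), interior_mono hsub ?_⟩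
  rw [hU.interior_eq]
  intro i
  simp only [mem_Ioo]
  norm_num

/-- A translation-invariant law of finite density has an intensity measure finite on compacts. -/
theorem isFiniteMeasureOnCompacts_bind_countKernel_map_fst
    {μ : Measure (PointConfig (EuclideanSpace ℝ d × EuclideanSpace ℝ d))} (h : IsTranslationInvariant μ)
    (hρ : PointProcess.density μ ≠ ∞) :
    IsFiniteMeasureOnCompacts ((μ.bind PointConfig.countKernel).map Prod.fst) := by
  haveI := isAddLeftInvariant_bind_countKernel_map_fst h
  rw [density_eq_bind_countKernel_map_fst_unitCube] at hρ
  exact ⟨fun K hK => measure_lt_top_of_isCompact_of_isAddLeftInvariant' interior_unitCube_nonempty hρ hK⟩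

/-- **The intensity measure of a translation-invariant law of finite density is a constant multiple
of Lebesgue measure** (uniqueness of Haar measure; Daley–Vere-Jones Prop. 12.2.I). -/
theorem exists_bind_countKernel_map_fst_eq_smul_volume
    {μ : Measure (PointConfig (EuclideanSpace ℝ d × EuclideanSpace ℝ d))} (h : IsTranslationInvariant μ)
    (hρ : PointProcess.density μ ≠ ∞) :
    ∃ a : ℝ≥0, (μ.bind PointConfig.countKernel).map Prod.fst = a • (volume : Measure (EuclideanSpace ℝ d)) := by
  haveI := isAddLeftInvariant_bind_countKernel_map_fst h
  haveI := isFiniteMeasureOnCompacts_bind_countKernel_map_fst h hρ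
  exact ⟨_, Measure.isAddLeftInvariant_eq_smul _ _⟩

/-- **Scaling of the intensity**: `E_μ[N(c⁻¹Λ × ℝᵈ)] = |c|⁻ᵈ · E_μ[N(Λ × ℝᵈ)]` for a
translation-invariant law of finite density (`c ≠ 0`, `Λ` measurable). -/
theorem lintegral_count_preimage_smul
    {μ : Measure (PointConfig (EuclideanSpace ℝ d × EuclideanSpace ℝ d))} (h : IsTranslationInvariant μ)
    (hρ : PointProcess.density μ ≠ ∞) {c : ℝ} (hc : c ≠ 0) {Λ : Set (EuclideanSpace ℝ d)}
    (hΛ : MeasurableSet Λ) :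
    ∫⁻ ω, ((ω.count (Prod.fst ⁻¹' ((c • ·) ⁻¹' Λ)) : ℕ∞) : ℝ≥0∞) ∂μ =
      ENNReal.ofReal |(c ^ Module.finrank ℝ (EuclideanSpace ℝ d))⁻¹| *
        ∫⁻ ω, ((ω.count (Prod.fst ⁻¹' Λ) : ℕ∞) : ℝ≥0∞) ∂μ := by
  obtain ⟨a, ha⟩ := exists_bind_countKernel_map_fst_eq_smul_volume h hρ
  rw [← bind_countKernel_map_fst_apply μ (measurable_const_smul c hΛ), ← bind_countKernel_map_fst_apply μ hΛ,
    ha, Measure.smul_apply, Measure.smul_apply, Measure.addHaar_preimage_smul volume hc,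
    ENNReal.smul_def, ENNReal.smul_def, smul_eq_mul, smul_eq_mul, mul_left_comm]

/-- **The density of a dilated state**: for a translation-invariant law `μ` of finite density, the
image under the spatial dilation `D(q, v) = (c q, v)` (`c > 0`) has density `c⁻ᵈ · density μ` (the
unit cube downstairs is the cube of side `c⁻¹` upstairs). -/
theorem density_map_dilate {μ : Measure (PointConfig (EuclideanSpace ℝ d × EuclideanSpace ℝ d))}
    (h : IsTranslationInvariant μ) (hρ : PointProcess.density μ ≠ ∞) {c : ℝ} (hc : 0 < c)
    {D : EuclideanSpace ℝ d × EuclideanSpace ℝ d ≃ₜ EuclideanSpace ℝ d × EuclideanSpace ℝ d}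
    (hD : ∀ p, D p = (c • p.1, p.2)) :
    PointProcess.density (μ.map (PointConfig.mapHomeomorph D)) =
      ENNReal.ofReal ((c ^ Fintype.card d)⁻¹) * PointProcess.density μ := by
  have hmeas : Measurable (PointConfig.mapHomeomorph D :
      PointConfig (EuclideanSpace ℝ d × EuclideanSpace ℝ d) → PointConfig (EuclideanSpace ℝ d × EuclideanSpace ℝ d)) :=
    PointConfig.measurable_mapHomeomorph _
  unfold PointProcess.density
  rw [lintegral_map (PointProcess.measurable_count_window Torus.measurableSet_unitCube) hmeas]
  simp_rw [PointConfig.count_mapHomeomorph, preimage_dilate_fst_preimage hD]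
  rw [lintegral_count_preimage_smul h hρ hc.ne' Torus.measurableSet_unitCube, finrank_euclideanSpace,
    abs_of_pos (inv_pos.2 (pow_pos hc _))]

end Intensity

/-! ## F1 from the low-activity gas: the density-one state at diameter `σ` -/

/-- **F1 FROM THE LOW-ACTIVITY GAS** (REGISTERED helper stub `diluteGibbsDensityOne_of_ruelle` of
stub F1 `stub_diluteGibbsDensityOne`, line `birth`, crux stmt-AtomisticToContinuum-9584): assuming the
named fact `RuelleDiluteHardSphereGas` (unit-diameter translation-invariant DLR states of density
`ρ(z)`, `ρ` continuous on `(0, z₁)` with `z - Cz² ≤ ρ(z) ≤ z`), for every `0 < σ < σ₁ :=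
min 1 (min (z₁/4) (1/(4C+4)))` and `θ > 0` there is a translation-invariant Gibbs state of the
hard-sphere gas of diameter `σ`, inverse temperature `θ⁻¹`, zero drift and DENSITY ONE: the
intermediate value theorem on `[σ³, 2σ³]` gives `z⋆` with `ρ(z⋆) = σ³`, and the unit-diameter state at
`z⋆` dilated by `σ` has diameter `σ`, activity `z⋆/σ³ > 0` and density `σ⁻³ σ³ = 1`. -/
theorem diluteGibbsDensityOne_of_ruelle : RuelleDiluteHardSphereGas →
    ∃ σ₁ : ℝ, 0 < σ₁ ∧ ∀ σ : ℝ, 0 < σ → σ < σ₁ → ∀ θ : ℝ, 0 < θ →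
      ∃ z : ℝ, 0 < z ∧ ∃ μ : Measure MarkedConfig,
        IsHardSphereGibbs σ z θ⁻¹ (0 : V3) μ ∧ IsTranslationInvariant μ ∧ PointProcess.density μ = 1 := by
  rintro ⟨z₁, C, hz₁, hC, ρ, hρ, hbd, hgas⟩
  refine ⟨min 1 (min (z₁ / 4) (1 / (4 * C + 4))), by positivity, ?_⟩
  intro σ hσ hσlt θ hθ
  -- the threshold: `σ ≤ 1`, `σ < z₁ / 4`, `σ < 1 / (4C + 4)`
  have hσ1 : σ ≤ 1 := hσlt.le.trans (min_le_left _ _)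
  have hσz : σ < z₁ / 4 := hσlt.trans_le ((min_le_right _ _).trans (min_le_left _ _))
  have hσC : σ < 1 / (4 * C + 4) := hσlt.trans_le ((min_le_right _ _).trans (min_le_right _ _))
  -- `s := σ³` satisfies `0 < s ≤ σ`
  set s : ℝ := σ ^ 3 with hs_def
  have hs : 0 < s := by positivity
  have hsσ : s ≤ σ := by
    calc s = σ * (σ * σ) := by rw [hs_def]; ring
      _ ≤ σ * (1 * 1) := by gcongr
      _ = σ := by ring
  have h2s : 2 * s < z₁ := by linarith
  have hCs : 4 * C * s ≤ 1 := by
    have h4 : 0 < 4 * C + 4 := by positivity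
    have h1 : σ * (4 * C + 4) < 1 := by
      calc σ * (4 * C + 4) < 1 / (4 * C + 4) * (4 * C + 4) := by gcongr
        _ = 1 := by field_simp
    nlinarith
  -- the density at the two ends of `[s, 2s]`
  have hlow : ρ s ≤ s := (hbd s hs (by linarith)).2
  have hhigh : s ≤ ρ (2 * s) := by
    have h := (hbd (2 * s) (by positivity) h2s).1
    nlinarith
  -- intermediate value theorem on `[s, 2s] ⊆ (0, z₁)`
  have hcont : ContinuousOn ρ (Icc s (2 * s)) :=
    hρ.mono fun z hz => ⟨hs.trans_le hz.1, hz.2.trans_lt h2s⟩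
  obtain ⟨z, hz, hρz⟩ := intermediate_value_Icc (by linarith) hcont ⟨hlow, hhigh⟩
  have hz0 : 0 < z := hs.trans_le hz.1
  -- the unit-diameter state of activity `z`, density `ρ z = σ³`, at `β = θ⁻¹`, `u = 0`
  obtain ⟨G, hG, hGT, hGd⟩ := hgas θ⁻¹ (inv_pos.2 hθ) 0 z hz0 (hz.2.trans_lt h2s)
  have hGd' : PointProcess.density G ≠ ∞ := by rw [hGd]; exact ENNReal.ofReal_ne_top
  -- dilate by `σ`: diameter `σ * 1`, activity `z / σ³`, density `σ⁻³ * σ³`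
  set D : V3 × V3 ≃ₜ V3 × V3 := (Homeomorph.smulOfNeZero σ hσ.ne').prodCongr (Homeomorph.refl V3) with hDdef
  have hD : ∀ p, D p = (σ • p.1, p.2) := fun _ => rfl
  refine ⟨z / σ ^ 3, by positivity, G.map (PointConfig.mapHomeomorph D), ?_,
    isTranslationInvariant_map_dilate hσ.ne' hD hGT, ?_⟩
  · have h := hG.map_dilate hσ hD
    rwa [mul_one, Fintype.card_fin] at h
  · rw [density_map_dilate hGT hGd' hσ hD, hGd, hρz, Fintype.card_fin,
      ← ENNReal.ofReal_mul (inv_nonneg.2 hs.le), inv_mul_cancel₀ hs.ne', ENNReal.ofReal_one]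

end Summit.AtomisticToContinuum.HydrodynamicLimit.Theorems.MourreKoopmanChargesStressStrongMixing

end
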